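import Summits.NavierStokesRegularity.NavierStokesRegularity.Theorems.SwirlFreeBudget
import Summits.NavierStokesRegularity.NavierStokesRegularity.Theorems.AxisymmetricExtremalityAxisymmetricKatoGlobalStubSereginLogSwirlOrigin
import Summits.NavierStokesRegularity.NavierStokesRegularity.Theorems.AxisymmetricExtremalityAxisymmetricKatoGlobalStubSeregin2020TypeIINoSwirlSingularStructure
import Literature.Analysis.FluidPDE.SuitableWeakInBallTools
import Literature.Analysis.FluidPDE.ESSLocalHolderBlowupLimit
import Literature.Analysis.FluidPDE.LocalTypeIScaling
import Literature.Analysis.FluidPDE.SereginSverakBlowupSelection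
import Literature.Analysis.FluidPDE.SereginSverakPressureDecayBalls
import HarnessLib

/-!
# SwirlFreeBudget, crux K-18.2 (T-18.5), step "suitable-weak → smooth": backward boundedness at
# AXIS points of a swirl-free axisymmetric suitable weak solution (seat nsreg-p4 g12)

Support file for the DORMANT route `SwirlThreshold` (crux stmt-NavierStokesRegularity-2002) and
planner nsreg-p2's ROUND-18 assembly `EtaMoserBound → SwirlFreePolynomialBound`
(`…Theorems.SwirlFreeBudget`).  The smooth-case core (`smooth_velocity_bound_of_gauges`, part
`…SmoothGauged`) consumes the Seregin–Zajączkowski smooth class on an axis-centred OPEN cylinder;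
to feed it from a suitable weak solution one needs every interior point to be a regular point.
Off the axis this is Caffarelli–Kohn–Nirenberg for axisymmetric solutions (tree:
`isRegularPoint_of_cylRadius_ne_zero`); ON the axis it is the classical regularity of swirl-free
axisymmetric flows (Ladyzhenskaya 1968, Ukhovskii–Yudovich 1968), which the tree holds in the
sharper LOCAL form of Seregin's logarithmic swirl criterion (J. Math. Fluid Mech. 24 (2022) §2,
DISCHARGED: `seregin2022_logSwirl_regularAtOrigin_holds`) — a vanishing swirl satisfies the
criterion's bound `|σ| ≤ C₁/ln³(e/|x'|)` with `C₁ = 0`.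

* `hasNoSwirl_smul_comp_axis`, `isAxisymmetricScalar_comp_axis` — the axis-centred parabolic
  zoom keeps "no swirl" and scalar axial symmetry (the vector version is the tree's
  `SereginSverak2009.isAxisymmetric_rescale`);
* `exists_eLpNorm_lt_top_of_hasNoSwirl_axis` — **an Albritton–Barker suitable weak solution in
  `Q(z, r)` about an AXIS point `z`, with axisymmetric swirl-free slices (pointwise) and
  axisymmetric pressure slices, is essentially bounded on some `Q(z, ρ)`**: zoom `Q(z, r)` to
  `Q(0, 2)` (`IsSuitableWeakSolutionInBall.zoom`, `.zoomOut`), restrict to Seregin's block on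
  `𝒞 × ]-1, 0[` (`parCyl_block_of_inBall`), apply the criterion, transport the bound back
  (`eLpNorm_lt_top_of_zoom`, `eLpNorm_top_nsZoom`).

WHAT THIS IS NOT: not NS regularity — a qualitative regularity statement for the SWIRL-FREE class
(classical since 1968) assembled from proved tree theorems; `SwirlFreePolynomialBound`,
`EtaMoserBound` and all hard cores untouched; no crux claim.
-/

namespace Summit.NavierStokesRegularity.NavierStokesRegularity.Theorems.SwirlFreeBudget

open MeasureTheory Set Filter Topology Metric Function
open scoped ENNReal NNReal
open Literature.Analysis Literature.Analysis.FluidPDE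
open Summit.NavierStokesRegularity.NavierStokesRegularity.Theorems.AxisymmetricKatoGlobal.EulerScaling

noncomputable section

/-- **The axis-centred affine zoom keeps "no swirl".**  For `c` on the axis, `b ≠ 0` and a
swirl-free `w`, the field `y ↦ a • w (c + b • y)` is swirl free:
`b · swirl (a w(c + b·)) (y) = a · swirl w (c + b y)` because `(c + b y)' = b y'`. -/
theorem hasNoSwirl_smul_comp_axis {w : EuclideanSpace ℝ (Fin 3) → EuclideanSpace ℝ (Fin 3)}
    (hw : HasNoSwirl w) {c : EuclideanSpace ℝ (Fin 3)} (hc : cylRadius c = 0) (a : ℝ) {b : ℝ}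
    (hb : b ≠ 0) : HasNoSwirl fun y => a • w (c + b • y) := by
  intro y
  obtain ⟨hc0, hc1⟩ := (cylRadius_eq_zero_iff c).1 hc
  have h := hw (c + b • y)
  simp only [swirl, PiLp.add_apply, PiLp.smul_apply, smul_eq_mul, hc0, hc1, zero_add] at h ⊢
  have h' : b * (y 0 * w (c + b • y) 1 - y 1 * w (c + b • y) 0) = 0 := by
    rw [← h]; ring
  rcases mul_eq_zero.1 h' with h'' | h''
  · exact absurd h'' hb
  · calc y 0 * (a * w (c + b • y) 1) - y 1 * (a * w (c + b • y) 0)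
        = a * (y 0 * w (c + b • y) 1 - y 1 * w (c + b • y) 0) := by ring
      _ = 0 := by rw [h'', mul_zero]

/-- **The axis-centred affine zoom keeps scalar axial symmetry**: for an axisymmetric scalar `f`,
`y ↦ a • f (β e₃ + b • y)` is axisymmetric (`R_θ (β e₃ + b y) = β e₃ + b R_θ y`). -/
theorem isAxisymmetricScalar_comp_axis {f : EuclideanSpace ℝ (Fin 3) → ℝ}
    (hf : IsAxisymmetricScalar f) (a β b : ℝ) :
    IsAxisymmetricScalar fun y => a • f (β • eZ + b • y) := by
  intro θ y
  simp only
  rw [← SereginSverak2009.rotZ_smul_eZ_add_smul, hf θ]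

/-- **Backward boundedness at axis points of swirl-free axisymmetric suitable weak solutions.**
Let `(v, q)` be a suitable weak solution in Albritton–Barker's class on `Q(z, r)` (`r > 0`) about an
AXIS point `z` (`cylRadius z.2 = 0`), every slice `v s` axisymmetric and swirl free (pointwise), the
pressure slices `q t` axisymmetric for `t` in the time window.  Then `v ∈ L^∞(Q(z, ρ))` for some
`ρ > 0`.  Proof: the zoom `V(s, y) = (r/2) v(z.1 + (r/2)² s, z.2 + (r/2) y)` (composed of
`IsSuitableWeakSolutionInBall.zoom` and `.zoomOut (c := 1/2)`) is in the class on `Q(0, 2)`, hence in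
Seregin's block on `𝒞 × ]-1, 0[` (`parCyl_block_of_inBall`), axisymmetric with axisymmetric
pressure and ZERO swirl, so the DISCHARGED criterion `seregin2022_logSwirl_regularAtOrigin_holds`
(with `C₁ = 0`) makes the origin regular; the bound is transported back along the zoom. -/
theorem exists_eLpNorm_lt_top_of_hasNoSwirl_axis
    {v : ℝ → EuclideanSpace ℝ (Fin 3) → EuclideanSpace ℝ (Fin 3)}
    {q : ℝ → EuclideanSpace ℝ (Fin 3) → ℝ} {z : ℝ × EuclideanSpace ℝ (Fin 3)} {r : ℝ} (hr : 0 < r)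
    (hball : IsSuitableWeakSolutionInBall r z v q) (hax : ∀ s, IsAxisymmetric (v s))
    (hns : ∀ s, HasNoSwirl (v s))
    (hqax : ∀ t ∈ Ioo (z.1 - r ^ 2) z.1, IsAxisymmetricScalar (q t)) (hz : cylRadius z.2 = 0) :
    ∃ ρ > 0, eLpNorm (uncurry v) ∞ (volume.restrict (parabolicCylinder ρ z)) < ∞ := by
  -- the axis point is `b e₃`
  obtain ⟨b, hb⟩ : ∃ b : ℝ, z.2 = b • eZ := by
    refine ⟨z.2 2, ?_⟩
    have h := SereginSverak2009.horiz_add_smul_eZ z.2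
    have h0 : SereginSverak2009.horiz z.2 = 0 := by
      rw [← norm_eq_zero, SereginSverak2009.norm_horiz]; exact hz
    rw [h0, zero_add] at h
    exact h.symm
  -- ### the zoom to `Q(0, 1)`, then out to `Q(0, 2)`
  set U₁ : ℝ → EuclideanSpace ℝ (Fin 3) → EuclideanSpace ℝ (Fin 3) :=
    r • stPull (r ^ 2) r z.1 z.2 v with hU₁
  set P₁ : ℝ → EuclideanSpace ℝ (Fin 3) → ℝ := r ^ 2 • stPull (r ^ 2) r z.1 z.2 q with hP₁
  have h1 : IsSuitableWeakSolutionInBall 1 (0 : ℝ × EuclideanSpace ℝ (Fin 3)) U₁ P₁ := hball.zoom hr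
  have hhalf : (0 : ℝ) < 1 / 2 := by norm_num
  have h2 := h1.zoomOut hhalf
  rw [show (1 : ℝ) / (1 / 2) = 2 by norm_num] at h2
  set U₂ : ℝ → EuclideanSpace ℝ (Fin 3) → EuclideanSpace ℝ (Fin 3) :=
    (1 / 2 : ℝ) • stPull ((1 / 2 : ℝ) ^ 2) (1 / 2) (0 : ℝ) (0 : EuclideanSpace ℝ (Fin 3)) U₁ with hU₂
  set P₂ : ℝ → EuclideanSpace ℝ (Fin 3) → ℝ :=
    (1 / 2 : ℝ) ^ 2 • stPull ((1 / 2 : ℝ) ^ 2) (1 / 2) (0 : ℝ) (0 : EuclideanSpace ℝ (Fin 3)) P₁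
    with hP₂
  obtain ⟨hsw, hA, hG, hp⟩ := parCyl_block_of_inBall h2
  -- ### symmetry, pressure symmetry and zero swirl of the zoomed field
  have hU₁ax : ∀ s, IsAxisymmetric (U₁ s) := by
    intro s
    have e : U₁ s = fun y => r • v (z.1 + r ^ 2 * s) (b • eZ + r • y) := by
      funext y; rw [hU₁, smul_stPull_apply, hb]
    rw [e]
    exact SereginSverak2009.isAxisymmetric_rescale (hax _) r b r
  have hU₂ax : ∀ t ∈ Ioo (-1 : ℝ) 0, IsAxisymmetric (U₂ t) := fun t _ =>
    isAxisymmetric_zoom hU₁ax (1 / 2) t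
  have hU₁ns : ∀ s, HasNoSwirl (U₁ s) := by
    intro s
    have e : U₁ s = fun y => r • v (z.1 + r ^ 2 * s) (z.2 + r • y) := by
      funext y; rw [hU₁, smul_stPull_apply]
    rw [e]
    exact hasNoSwirl_smul_comp_axis (hns _) hz r hr.ne'
  have hU₂ns : ∀ t, HasNoSwirl (U₂ t) := by
    intro t
    have e : U₂ t = fun y => (1 / 2 : ℝ) • U₁ (0 + (1 / 2 : ℝ) ^ 2 * t)
        ((0 : EuclideanSpace ℝ (Fin 3)) + (1 / 2 : ℝ) • y) := by
      funext y; rw [hU₂, smul_stPull_apply]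
    rw [e]
    exact hasNoSwirl_smul_comp_axis (hU₁ns _) (by simp [cylRadius]) (1 / 2) hhalf.ne'
  have hP₂ax : ∀ t ∈ Ioo (-1 : ℝ) 0, IsAxisymmetricScalar (P₂ t) := by
    intro t ht
    -- the corresponding time of `q` lies in the window of `Q(z, r)`
    have hτ : z.1 + r ^ 2 * ((1 / 2 : ℝ) ^ 2 * t) ∈ Ioo (z.1 - r ^ 2) z.1 := by
      have hr2 : 0 < r ^ 2 := by positivity
      constructor <;> nlinarith [ht.1, ht.2]
    have e : P₂ t = fun y => ((1 / 2 : ℝ) ^ 2 * r ^ 2) •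
        q (z.1 + r ^ 2 * ((1 / 2 : ℝ) ^ 2 * t)) (b • eZ + (r * (1 / 2 : ℝ)) • y) := by
      funext y
      rw [hP₂, smul_stPull_apply, hP₁, smul_stPull_apply, hb, zero_add, zero_add, smul_smul,
        smul_eq_mul, smul_smul, smul_eq_mul]
    rw [e]
    exact isAxisymmetricScalar_comp_axis (hqax _ hτ) _ b _
  have hσ : ∃ C₁ : ℝ, ∀ t ∈ Ioo (-1 : ℝ) 0, ∀ x ∈ SereginSverak2009.spaceCyl 0 1, 0 < cylRadius x →
      |swirl (U₂ t) x| ≤ C₁ / Real.log (Real.exp 1 / cylRadius x) ^ 3 := by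
    refine ⟨0, fun t _ x _ _ => ?_⟩
    rw [hU₂ns t x, abs_zero, zero_div]
  -- ### Seregin's criterion at the origin, and the transport back
  obtain ⟨ρ, hρ, hfin⟩ := seregin2022_logSwirl_regularAtOrigin_holds U₂ P₂ hsw hA hG hp hU₂ax hP₂ax hσ
  -- `Q(0, ρ) ⊆ 𝒞(ρ) × ]-ρ², 0[`
  have hfin₂ : eLpNorm (uncurry U₂) ∞
      (volume.restrict (parabolicCylinder ρ (0 : ℝ × EuclideanSpace ℝ (Fin 3)))) < ∞ :=
    (eLpNorm_mono_measure _ (Measure.restrict_mono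
      (parabolicCylinder_subset_parCyl (0 : ℝ × EuclideanSpace ℝ (Fin 3)) ρ) le_rfl)).trans_lt hfin
  -- undo the dilation by `1/2`
  have hfin₁ : eLpNorm (uncurry U₁) ∞
      (volume.restrict (parabolicCylinder ((1 / 2 : ℝ) * ρ) (0 : ℝ × EuclideanSpace ℝ (Fin 3)))) < ∞ := by
    have h := eLpNorm_lt_top_of_zoom (w := U₁) (z' := (0 : ℝ × EuclideanSpace ℝ (Fin 3))) hhalf hfin₂
    have e0 : (((1 / 2 : ℝ) ^ 2 * (0 : ℝ × EuclideanSpace ℝ (Fin 3)).1,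
        (1 / 2 : ℝ) • (0 : ℝ × EuclideanSpace ℝ (Fin 3)).2) : ℝ × EuclideanSpace ℝ (Fin 3)) = 0 := by
      rw [Prod.fst_zero, Prod.snd_zero, mul_zero, smul_zero]; rfl
    rwa [e0] at h
  -- undo the zoom `Q(z, r) → Q(0, 1)`
  have key := eLpNorm_top_nsZoom hr z.1 z.2 ((1 / 2 : ℝ) * ρ) (0 : ℝ × EuclideanSpace ℝ (Fin 3)) v
  have hst : stAffine (r ^ 2) r z.1 z.2 (0 : ℝ × EuclideanSpace ℝ (Fin 3)) = z := by
    rw [show (0 : ℝ × EuclideanSpace ℝ (Fin 3)) = ((0 : ℝ), (0 : EuclideanSpace ℝ (Fin 3))) from rfl,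
      stAffine_apply, mul_zero, smul_zero, add_zero, add_zero]
  rw [hst] at key
  refine ⟨r * ((1 / 2 : ℝ) * ρ), by positivity, ?_⟩
  by_contra htop
  rw [not_lt, top_le_iff] at htop
  rw [← hU₁, htop, ENNReal.mul_top (ENNReal.ofReal_pos.2 hr).ne'] at key
  exact (lt_irrefl _) (key ▸ hfin₁)

end

end Summit.NavierStokesRegularity.NavierStokesRegularity.Theorems.SwirlFreeBudget
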